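import Summits.AtomisticToContinuum.Crystallization.Theorems.FrustratedLawDichotomyStrainedPatchHomCurvDispatch
import Summits.AtomisticToContinuum.Crystallization.Theorems.FrustratedLawDichotomyStrainedPatchHomCurvKit
import Summits.AtomisticToContinuum.Crystallization.Theorems.FrustratedLawDichotomyStrainedPatchHomLatticeBoxHcp

/-!
# The CURVATURE LEAF of lever (C): a kernel Boolean over an entry/shuffle box certifying the `λ`-input of `hcpShifted_floor_W45`

decomp-a2c hand-1 g26 (crux `AperiodicFrustratedLawGap`, stmt-AtomisticToContinuum-27623; `(H) HomFloor (1/625)`, hcp half; critic rows 1026 (C) /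
1030: «the λ-certificate over the (U, ξ)-box is the open kernel item of (C)»).  Assembly of the kit:

* per label `b` of a list `L`: `C_b := vecB E X b` (hand-2's `…HomForceKit`, entry intervals `E` and shuffle intervals `X` from the box `(c, w)`),
  `Q_b := ⟪C_b, C_b⟫` (`dot3`), `(A_b, B_b) := coeffFI Q_b` (`…HomCurvDispatch`, all radial regimes, hulls at straddles);
* `curvCheck c w L lamS : Bool` := every `coeffFI` succeeds ∧ `domTest (hessEntryFI L A B C) lamS` (`…HomCurvKit`);
* ★★★ `curv_floor_of_curvCheck` — SOUNDNESS: for `U` with entries in the box and `‖U − 1‖ ≤ 1/4`, and ANY two shuffles `ξ₀, ξ` in the box with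
  norms `≤ 1/4`, at every parameter `s ∈ (0,1)` whose radii avoid the junctions:
  `(lamS/SC)·‖U(ξ − ξ₀)‖² ≤ Σ_{b ∈ L} segGd (deriv W₄₅) (latPt U hexFrame b + U(hcpShift + ξ₀)) (U(ξ − ξ₀)) s`
  — literally the `hcurv` hypothesis of `…HomConvexSegmentW45.hcpShifted_floor_W45` with `λ = lamS/SC` and `B = L.toFinset`.

One kernel definition + soundness; 0 sorry; standard axioms; no instances / notation / `#eval`.  `--supports stmt-AtomisticToContinuum-27623`.
-/

noncomputable section

namespace Summit.AtomisticToContinuum.Crystallization.Theorems.FrustratedLawDichotomyStrainedPatchHomCurvLeaf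

open scoped BigOperators RealInnerProductSpace
open Literature.Analysis.ValidatedNumerics.Numerics
open Summit.AtomisticToContinuum.Crystallization.Theorems.ChargedEnergyGapNegative (E3)
open Summit.AtomisticToContinuum.Crystallization.Theorems.FrustratedLawDichotomySchurCut (effPot w₄₅ ω₄)
open Summit.AtomisticToContinuum.Crystallization.Theorems.FrustratedLawDichotomyStrainedPatchHomSplit (latPt hexFrame hcpShift)
open Summit.AtomisticToContinuum.Crystallization.Theorems.FrustratedLawDichotomyStrainedPatchHomEntryGram (entryFI mem_entryFI)
open Summit.AtomisticToContinuum.Crystallization.Theorems.FrustratedLawDichotomyStrainedPatchHomEntryGramHcp (dot3 shufFI mem_dot3 mem_shufFI)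
open Summit.AtomisticToContinuum.Crystallization.Theorems.FrustratedLawDichotomyStrainedPatchHomForceKit (vecB mem_vecB)
open Summit.AtomisticToContinuum.Crystallization.Theorems.FrustratedLawDichotomyStrainedPatchHomCurvCoeff (coeffFI mem_coeffFI)
open Summit.AtomisticToContinuum.Crystallization.Theorems.FrustratedLawDichotomyStrainedPatchHomCurvKit
  (hessEntryFI domTest curvatureSum_ge_of_domTest)
open Summit.AtomisticToContinuum.Crystallization.Theorems.FrustratedLawDichotomyStrainedPatchHomConvexCurvature (segGd_eq_rankOne)
open Summit.AtomisticToContinuum.Crystallization.Theorems.FrustratedLawDichotomyStrainedPatchTaylorChord (segR segGd)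
open Summit.AtomisticToContinuum.Crystallization.Theorems.FrustratedLawDichotomyStrainedPatchTaylorLeaves (junctions)
open Summit.AtomisticToContinuum.Crystallization.Theorems.FrustratedLawDichotomyStrainedPatchHomLatticeBoxHcp (norm_shifted_gt)

/-! ## §1. The Boolean -/

/-- ★ **CURVATURE CHECK** over the twelve-coordinate box `(c, w)` (`Sum.inl` = entries of `U`, `Sum.inr` = shuffle), label list `L`, floor `lamS/SC`:
all per-label coefficient enclosures succeed and the Hessian-entry accumulator passes the dominance test. -/
def curvCheck (c w : (Fin 3 × Fin 3) ⊕ Fin 3 → ℤ) (L : List (Fin 3 → ℤ)) (lamS : ℤ) : Bool :=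
  let E := entryFI (fun ab => c (Sum.inl ab)) (fun ab => w (Sum.inl ab))
  let X := shufFI c w
  let C : (Fin 3 → ℤ) → Fin 3 → FI := fun b => vecB E X b
  let K : (Fin 3 → ℤ) → Option (FI × FI) := fun b => coeffFI (dot3 (C b) (C b))
  (L.all fun b => (K b).isSome) &&
    domTest (hessEntryFI L (fun b => ((K b).getD (FI.ofInt 0, FI.ofInt 0)).1) (fun b => ((K b).getD (FI.ofInt 0, FI.ofInt 0)).2) C) lamS

/-! ## §2. Soundness -/

/-- A convex combination of two box members is a box member (coordinatewise). [folklore] -/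
theorem abs_sub_le_of_segment {x y m r s : ℝ} (hx : |x - m| ≤ r) (hy : |y - m| ≤ r) (h0 : 0 ≤ s) (h1 : s ≤ 1) :
    |x + s * (y - x) - m| ≤ r := by
  rw [abs_le] at hx hy ⊢
  constructor <;> nlinarith [hx.1, hx.2, hy.1, hy.2]

/-- ★★★ **SOUNDNESS OF THE CURVATURE LEAF.**  If `curvCheck c w L lamS = true` (`L` duplicate-free) then for every `U` with entries in the box and
`‖U − 1‖ ≤ 1/4`, all shuffles `ξ₀, ξ` in the box with `‖ξ₀‖, ‖ξ‖ ≤ 1/4`, and every `s ∈ (0,1)` at which the radii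
`‖latPt U hexFrame b + U(hcpShift + ξ₀) + s·U(ξ − ξ₀)‖`, `b ∈ L`, avoid the junction radii:
`(lamS/SC)·‖U(ξ − ξ₀)‖² ≤ Σ_{b ∈ L.toFinset} segGd (deriv W₄₅) (latPt U hexFrame b + U(hcpShift + ξ₀)) (U(ξ − ξ₀)) s` — the `hcurv` input of
`…HomConvexSegmentW45.hcpShifted_floor_W45` (`W₄₅ = effPot w₄₅ ω₄ (3/400) = Wrec`). [folklore chaining] -/
theorem curv_floor_of_curvCheck {c w : (Fin 3 × Fin 3) ⊕ Fin 3 → ℤ} {L : List (Fin 3 → ℤ)} (hL : L.Nodup) {lamS : ℤ}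
    (h : curvCheck c w L lamS = true) (U : E3 →L[ℝ] E3) (hU : ‖U - 1‖ ≤ 1 / 4)
    (hbox : ∀ ab : Fin 3 × Fin 3, |(U (EuclideanSpace.single ab.2 (1 : ℝ))) ab.1 - (c (Sum.inl ab) : ℝ) / SC| ≤ (w (Sum.inl ab) : ℝ) / SC)
    (ξ₀ ξ : E3) (hξ₀ : ∀ i : Fin 3, |ξ₀ i - (c (Sum.inr i) : ℝ) / SC| ≤ (w (Sum.inr i) : ℝ) / SC)
    (hξ : ∀ i : Fin 3, |ξ i - (c (Sum.inr i) : ℝ) / SC| ≤ (w (Sum.inr i) : ℝ) / SC) (hn₀ : ‖ξ₀‖ ≤ 1 / 4) (hn : ‖ξ‖ ≤ 1 / 4)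
    {s : ℝ} (hs : s ∈ Set.Ioo (0 : ℝ) 1)
    (hgood : ∀ b ∈ L.toFinset, segR (latPt U hexFrame b + U (hcpShift + ξ₀)) (U (ξ - ξ₀)) s ∉ junctions) :
    (lamS : ℝ) / SC * ‖U (ξ - ξ₀)‖ ^ 2 ≤
      ∑ b ∈ L.toFinset, segGd (deriv (effPot w₄₅ ω₄ (3 / 400))) (latPt U hexFrame b + U (hcpShift + ξ₀)) (U (ξ - ξ₀)) s := by
  classical
  -- unpack the Boolean
  unfold curvCheck at h
  simp only [Bool.and_eq_true, List.all_eq_true] at h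
  obtain ⟨hall, hdom⟩ := h
  set E := entryFI (fun ab => c (Sum.inl ab)) (fun ab => w (Sum.inl ab)) with hE
  set X := shufFI c w with hX
  set C : (Fin 3 → ℤ) → Fin 3 → FI := fun b => vecB E X b with hC
  set K : (Fin 3 → ℤ) → Option (FI × FI) := fun b => coeffFI (dot3 (C b) (C b)) with hK
  -- the intermediate shuffle `η = ξ₀ + s(ξ − ξ₀)` is in the box and in the ball
  set η : E3 := ξ₀ + s • (ξ - ξ₀) with hη
  have hηbox : ∀ i : Fin 3, |η i - (c (Sum.inr i) : ℝ) / SC| ≤ (w (Sum.inr i) : ℝ) / SC := by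
    intro i
    have : η i = ξ₀ i + s * (ξ i - ξ₀ i) := by simp [hη]
    rw [this]
    exact abs_sub_le_of_segment (hξ₀ i) (hξ i) hs.1.le hs.2.le
  have hηn : ‖η‖ ≤ 1 / 4 := by
    have hdec : η = (1 - s) • ξ₀ + s • ξ := by
      rw [hη, smul_sub, sub_smul, one_smul]; abel
    rw [hdec]
    calc ‖(1 - s) • ξ₀ + s • ξ‖ ≤ ‖(1 - s) • ξ₀‖ + ‖s • ξ‖ := norm_add_le _ _
      _ = (1 - s) * ‖ξ₀‖ + s * ‖ξ‖ := by
          rw [norm_smul, norm_smul, Real.norm_eq_abs, Real.norm_eq_abs, abs_of_nonneg (by linarith [hs.2]), abs_of_nonneg hs.1.le]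
      _ ≤ (1 - s) * (1 / 4) + s * (1 / 4) := by gcongr <;> linarith [hs.1, hs.2]
      _ = 1 / 4 := by ring
  -- the point on the segment is the `B`-family displacement at shuffle `η`
  have hpt : ∀ b : Fin 3 → ℤ, latPt U hexFrame b + U (hcpShift + ξ₀) + s • U (ξ - ξ₀) = latPt U hexFrame b + U (hcpShift + η) := by
    intro b
    have : U (hcpShift + η) = U (hcpShift + ξ₀) + s • U (ξ - ξ₀) := by
      rw [hη, ← map_smul, ← map_add]; congr 1; abel
    rw [this, add_assoc]
  -- per-label memberships
  have hCmem : ∀ b : Fin 3 → ℤ, ∀ a : Fin 3, FI.mem ((latPt U hexFrame b + U (hcpShift + η)) a) (C b a) :=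
    fun b a => mem_vecB U η (fun ab => mem_entryFI (hbox ab)) (fun i => mem_shufFI (hηbox i)) b a
  have hQmem : ∀ b : Fin 3 → ℤ, FI.mem (‖latPt U hexFrame b + U (hcpShift + η)‖ ^ 2) (dot3 (C b) (C b)) := by
    intro b
    rw [← real_inner_self_eq_norm_sq]
    exact mem_dot3 (hCmem b) (hCmem b)
  have hρpos : ∀ b : Fin 3 → ℤ, 0 < ‖latPt U hexFrame b + U (hcpShift + η)‖ := fun b =>
    lt_trans (by norm_num) (norm_shifted_gt hU hηn b)
  -- `segR` at parameter `s` is that radius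
  have hsegR : ∀ b : Fin 3 → ℤ, segR (latPt U hexFrame b + U (hcpShift + ξ₀)) (U (ξ - ξ₀)) s = ‖latPt U hexFrame b + U (hcpShift + η)‖ := by
    intro b; rw [segR, hpt]
  -- the coefficient enclosures for the labels of `L`
  have hKsome : ∀ b ∈ L, ∃ AB, K b = some AB := fun b hb => Option.isSome_iff_exists.1 (hall b hb)
  have hA : ∀ b ∈ L, FI.mem ((deriv (deriv (effPot w₄₅ ω₄ (3 / 400))) ‖latPt U hexFrame b + U (hcpShift + η)‖ -
      deriv (effPot w₄₅ ω₄ (3 / 400)) ‖latPt U hexFrame b + U (hcpShift + η)‖ / ‖latPt U hexFrame b + U (hcpShift + η)‖) /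
      ‖latPt U hexFrame b + U (hcpShift + η)‖ ^ 2) ((K b).getD (FI.ofInt 0, FI.ofInt 0)).1 := by
    intro b hb
    obtain ⟨AB, hAB⟩ := hKsome b hb
    have hJ : ‖latPt U hexFrame b + U (hcpShift + η)‖ ∉ junctions := by
      rw [← hsegR]; exact hgood b (List.mem_toFinset.2 hb)
    have := (mem_coeffFI (hρpos b) hJ (hQmem b) hAB).1
    rw [hAB]; simpa using this
  have hB : ∀ b ∈ L, FI.mem (deriv (effPot w₄₅ ω₄ (3 / 400)) ‖latPt U hexFrame b + U (hcpShift + η)‖ / ‖latPt U hexFrame b + U (hcpShift + η)‖)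
      ((K b).getD (FI.ofInt 0, FI.ofInt 0)).2 := by
    intro b hb
    obtain ⟨AB, hAB⟩ := hKsome b hb
    have hJ : ‖latPt U hexFrame b + U (hcpShift + η)‖ ∉ junctions := by
      rw [← hsegR]; exact hgood b (List.mem_toFinset.2 hb)
    have := (mem_coeffFI (hρpos b) hJ (hQmem b) hAB).2
    rw [hAB]; simpa using this
  -- the kernel test ⟹ the rank-one curvature-sum floor
  have key := curvatureSum_ge_of_domTest L hL
    (α := fun b => (deriv (deriv (effPot w₄₅ ω₄ (3 / 400))) ‖latPt U hexFrame b + U (hcpShift + η)‖ -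
      deriv (effPot w₄₅ ω₄ (3 / 400)) ‖latPt U hexFrame b + U (hcpShift + η)‖ / ‖latPt U hexFrame b + U (hcpShift + η)‖) /
      ‖latPt U hexFrame b + U (hcpShift + η)‖ ^ 2)
    (β := fun b => deriv (effPot w₄₅ ω₄ (3 / 400)) ‖latPt U hexFrame b + U (hcpShift + η)‖ / ‖latPt U hexFrame b + U (hcpShift + η)‖)
    (c := fun b => latPt U hexFrame b + U (hcpShift + η)) hA hB (fun b _ a => hCmem b a) hdom (U (ξ - ξ₀))
  refine key.trans (le_of_eq (Finset.sum_congr rfl fun b _ => ?_))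
  -- identify each summand with `segGd` at parameter `s`
  have h0 : segR (latPt U hexFrame b + U (hcpShift + ξ₀)) (U (ξ - ξ₀)) s ≠ 0 := by rw [hsegR]; exact (hρpos b).ne'
  rw [segGd_eq_rankOne _ _ _ h0, hsegR, hpt]

end Summit.AtomisticToContinuum.Crystallization.Theorems.FrustratedLawDichotomyStrainedPatchHomCurvLeaf

end
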